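import Summits.QuantumFields.QCD.Theses.CounterexampleMustBeHot
import HarnessLib

/-!
# `CounterexampleMustBeHot.ChiralColdCertificateOfSplit` (support item stmt-QuantumFields-18920)

The glue of the typed decomposition of the former deciding crux `ChiralColdCertificate`
(stmt-QuantumFields-17303) of route `route-QuantumFields-CounterexampleMustBeHot`:
`ColdHotWitness → FreeEnergyLimits → GapImpliesCold → ChiralColdCertificate`.

Proof as prepared by the crux-strategist (planner) in
`Summits/QuantumFields/QCD/Cruxes/ChiralColdCertificate/ChiralColdCertificateOfSplit.lean` (namespace
`…Cruxes.ChiralColdCertificate.Split`) and inlined in the route's `closes`; landed here BY NAME under `Theorems/`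
(prover-only, D-0016) so that the item closes.  Three clauses of the parent are DERIVED rather than copied: the
physical-branch clause (from `m_crit(k) > −1` and `a_k m_f / Z_m(k) > 0`), the `Lim` clause (instantiating
`FreeEnergyLimits`), and `IsChiralAtZero` (contraposition: with `T := c·ε`, a uniform gap `ε` at the `θ`-hot tuple
`m(cε)` would make the thermal degree-of-freedom count eventually `≤ θ/2` while it is frequently `≥ θ`).

Pure logic over the route decls; no definitions, no named facts, no analysis.
-/

namespace Summit.QuantumFields.QCD.Theorems

open Summit.QuantumFields.QCD.Theses.CounterexampleMustBeHot (ChiralColdCertificateOfSplit)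

/-- **Glue of the decomposition (item stmt-QuantumFields-18920, BY NAME):**
`ColdHotWitness → FreeEnergyLimits → GapImpliesCold → ChiralColdCertificate`.  The physical-branch clause comes
from `m_crit(k) > −1` and positivity of `a_k m_f / Z_m(k)`; the limits from `FreeEnergyLimits`; chirality at zero by
the hot/cold clash at temperature `c·ε` through `GapImpliesCold`. [folklore] -/
theorem chiralColdCertificateOfSplit_proof : ChiralColdCertificateOfSplit := by
  -- adapted from Cruxes/ChiralColdCertificate/ChiralColdCertificateOfSplit.lean (planner cstrat-stmt-QuantumFields-17303-r1)
  intro h₁ h₂ h₃ Nf hNf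
  obtain ⟨reg, hms, has, hβ, hcrit, hcold, θ, hθ, hhot⟩ := h₁ Nf hNf
  -- (i) the bare trajectory of every positive tuple stays on the physical branch at EVERY k
  have hbranch : ∀ m : Fin Nf → ℝ, (∀ fl, 0 < m fl) →
      ∀ (fl : Fin Nf) (k : ℕ), -1 < (reg.scheme m 0 0).mq fl k := by
    intro m hm fl k
    rw [Literature.MathematicalPhysics.QuantumFieldTheory.QCDRegularisation.scheme_mq]
    have hpos : 0 < reg.a k * m fl / reg.Zm k :=
      div_pos (mul_pos (reg.a_pos k) (hm fl)) (reg.Zm_pos k)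
    linarith [hcrit k]
  refine ⟨reg, hms, ?_, has, fun m hm => ?_⟩
  · -- (ii) chirality at zero: a uniform gap ε would make the theory cold at T = c ε (GapImpliesCold),
    --      contradicting the heat certified near the chiral limit (ColdHotWitness) once limits exist
    intro ε hε
    obtain ⟨c, hc, hgapcold⟩ := h₃ Nf hNf reg hms has (θ / 2) (half_pos hθ)
    obtain ⟨m, hm, hhotm⟩ := hhot (c * ε) (mul_pos hc hε)
    refine ⟨m, hm, fun hgap => ?_⟩
    obtain ⟨φ, e₀, hφ⟩ := h₂ Nf hNf (reg.scheme m 0 0) hβ (hbranch m hm)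
    have hfreq := hhotm φ e₀ hφ
    have hev := hgapcold m hm (fun fl => Filter.Eventually.of_forall (hbranch m hm fl)) ε hε hgap φ e₀ hφ
      (c * ε) (mul_pos hc hε) le_rfl
    obtain ⟨k, hk₁, hk₂⟩ := (hfreq.and_eventually hev).exists
    linarith
  · -- (iii) the certificate at the positive tuple m: branch (i), limits (FreeEnergyLimits), coldness
    obtain ⟨φ, e₀, hφ⟩ := h₂ Nf hNf (reg.scheme m 0 0) hβ (hbranch m hm)
    obtain ⟨η, hη, T₁, hT₁, hc⟩ := hcold m hm
    exact ⟨fun fl => Filter.Eventually.of_forall (hbranch m hm fl), φ, e₀, hφ, η, hη, T₁, hT₁, hc φ e₀ hφ⟩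

end Summit.QuantumFields.QCD.Theorems
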